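import Summits.HodgeConjecture.HodgeConjecture.Theorems.K2LiuUnramifiedSectionOnCartanInert   -- ★ #27i (K2Liu-p01): `lambdaLoc_iotaLeftLocPi_cartan_inert`
import Summits.HodgeConjecture.HodgeConjecture.Theorems.K2LiuDoublingSliceAtPlace              -- ★ (EV) (K2Liu-p05): `exists_twoSided_modDelta_of_localDecomp`
import Summits.HodgeConjecture.HodgeConjecture.Theorems.K2LiuSplitSliceOfTorusDecay             -- ★ (K2Liu-p05): `iotaLeft_iotaA_placesEmbed_mulSingle` (the slice point)

/-!
# The HEIGHT DECAY along the Cartan family at an INERT place, WITHOUT MATRICES (organ (D-n) of (Bv-nonsplit), inert unramified-lattice case)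

Track B ∕ K2-LIT, hLiu418 = stmt-HodgeConjecture-24832; socket #32dR through ★ (R) `doublingHeightDecayLocal_of_slices`, ★
`doublingHeightDecayLocalR2_of_finSlices` and ★ (NS-i) `K2LiuNonsplitSliceOfRankOneDecay.integrable_placeSlice_of_rankOneDecay` (K2Liu-p04, p857259):
the finite slice at a non-split isotropic `v ∈ S` is integrable once the height DECAYS geometrically along a rank-one Cartan family.  LEAD F0P6-plan
(g11) M-155c (2); REPORT-FIRST `K2/K2Liu-p04/g3/REPORT-FIRST-32dR-BvNonsplit.K2Liup04g3.md` §1 (D-n).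

THE STATEMENT (`exists_decay_cartan_inert`).  Curve datum `(L, e : Fin 2 × Fin 1 ≃ Fin n, dV, dW)`; `v` inert in `L` (`w ∣ v`, `c w = w`); a `σ_w`-fixed
uniformizer `ϖ` of `L_w`; an integral hyperbolic frame `T ∈ GL₂(𝒪_w)` of the place form (`diag(dV)_w = σ_w(T)ᵀ·antidiag(1,1)·T`); a family
`t : ℕ → G_v = U(V)(L⁺_v)` with `(t m)_w = T⁻¹·diag(ϖ^m, ϖ^{−m})·T` (★ row 26 `K2LiuCartanFamilyInert`, K2Liu-p01).  For every continuous height `Φ > 0`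
of type `(P_Δ, modDelta)` on `H(𝔸)` there is `C > 0` with
  `Φ(ι_v^H(ι_v(t m, 1))) ≤ C · (√‖ϖ‖_w)^m`   for all `m`
(`‖ϖ‖_w = q_w⁻¹ = q_v⁻²` at an inert unramified `v`, so the ratio is `q_v⁻¹` — the `r` of ★ (NS-i), `r^τ·q_v² < 1 ⟺ τ > 2`).  COROLLARY
(`exists_sliceDecay_cartan_inert`): the same for the #32d slice `u ↦ Φ(ι(ιA placesEmbed_S(1, u at v), 1))` of the `H`-frame along `κ_v⁻¹ ∘ t` (★ K2Liu-p05
`iotaLeft_iotaA_placesEmbed_mulSingle`, ★ D5 `localCongr`).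
THE PROOF — no block matrices: read ★ #27i `Λ_{s,v}(ι_v(t m, 1)) = χ(ϖ)^m‖ϖ‖^{m(s+n/2)}` at the TRIVIAL Hecke character and `s := 1 − n/2`:
`Λ = ‖ϖ‖^m ≠ 0`, so `ι_v(t m, 1) = p·k` IS Siegel-integrally decomposable (★ D7a: `Λ` is `0` off `P_Δ(L⁺_v)·K_{H,v}`), `Λ = siegelCharLoc(p) =
χ(det_Δ)·modDelta(ι_v^H p)^{2s+n} = modDelta(ι_v^H p)²`, whence `modDelta(ι_v^H p) = √‖ϖ‖^m` EXACTLY (`exists_decomp_modDelta_cartan_inert`); then ★ (EV)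
`exists_twoSided_modDelta_of_localDecomp` gives the decay (and the matching lower bound).  Theorems only; no `sorry`; default heartbeats.
[Li1992, §3 Thm. 3.1]; [GelbartPiatetskishapiroRallis1987, Part A §6]; [Liu2011, §2C (2-4) p. 863]; [Tan1999, §1].
HONEST LABEL: HC_CM is proved only modulo the 7 printed citations (2 remaining named inputs: hLiu418 = stmt-HodgeConjecture-24832, h413 =
stmt-HodgeConjecture-24833) until rung 0 closes; count-neutral helper toward #32dR (the (D-n) input of ★ (NS-i) at inert unramified-lattice places; the
ramified ∕ non-unimodular non-split places need the general row-26 Cartan datum), retires nothing by itself.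
-/

set_option autoImplicit false
-- the mandated namespace repeats the single-problem summit's segment (`HodgeConjecture.HodgeConjecture`)
set_option linter.dupNamespace false

noncomputable section

open scoped Matrix
open NumberField IsDedekindDomain

namespace Summit.HodgeConjecture.HodgeConjecture.Cruxes.HLiu418.K2LiuNonsplitCartanDecayInert

open Literature.NumberTheory.Automorphic Literature.NumberTheory.Automorphic.UnitaryGroup Literature.NumberTheory.GaloisRepresentations
open Literature.NumberTheory.GelbartRogawski1991 Literature.NumberTheory.GelbartRogawski1991.GRConstruction
open Literature.NumberTheory.K2Lit Literature.NumberTheory.K2Lit.SiegelDoubled Literature.NumberTheory.K2Lit.PlaceSplitting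
open Summit.HodgeConjecture.HodgeConjecture.Cruxes.HLiu418.K2LiuUnramifiedSectionOnCartanInert
open Summit.HodgeConjecture.HodgeConjecture.Cruxes.HLiu418.K2LiuDoublingSliceAtPlace
open Summit.HodgeConjecture.HodgeConjecture.Cruxes.HLiu418.K2LiuSplitSliceOfTorusDecay
open Summit.HodgeConjecture.HodgeConjecture.Cruxes.HLiu418.K2LiuDoublingSliceLocalBridge

variable (L : Type) [Field L] [NumberField L] [IsCMField L]
variable {n : ℕ} (e : Fin 2 × Fin 1 ≃ Fin n)
  (dV : Fin 2 → L) (hdV : ∀ i, IsCMField.complexConj L (dV i) = dV i)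
  (dW : Fin 1 → L) (hdW : ∀ i, IsCMField.complexConj L (dW i) = dW i)
  (v : HeightOneSpectrum (𝓞 (Fp L)))

/-! ## §1 The trivial Hecke character -/

omit [IsCMField L] in
/-- the trivial Hecke character is unramified everywhere. [cite: TateThesis1967, §2.3] -/
theorem isUnramifiedAt_one (w : HeightOneSpectrum (𝓞 L)) : (1 : HeckeCharacter L).IsUnramifiedAt w := fun _ => rfl

omit [IsCMField L] in
/-- the trivial Hecke character has value `1` at every uniformizer. [cite: TateThesis1967, §2.3] -/
theorem valueAtUniformizer_one (w : HeightOneSpectrum (𝓞 L)) : (1 : HeckeCharacter L).valueAtUniformizer w = 1 := by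
  simp only [HeckeCharacter.valueAtUniformizer, HeckeCharacter.localComponent_apply, HeckeCharacter.one_apply, Units.val_one]

/-- `χ(det_Δ p) = 1` for the trivial character. [cite: Tan1999, §1] -/
theorem chiDet_one_character (p : HA L e dV hdV dW hdW) : chiDet L e dV hdV dW hdW (1 : HeckeCharacter L) p = 1 := by
  unfold chiDet
  split_ifs <;> rfl

/-- the local Siegel character of the trivial character is a pure modulus: `siegelCharLoc_v(1, s)(u) = modDelta(ι_v^H u)^{2s+n}`. [cite: Tan1999, §1] -/
theorem siegelCharLoc_one_character (s : ℂ) (u : UnitaryGroup.localPi L (IsCMField.complexConj L) (n + n) (hermD L e dV hdV dW hdW) v) :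
    siegelCharLoc L e dV hdV dW hdW v (1 : HeckeCharacter L) s u =
      ((modDelta L e dV hdV dW hdW (locToAdelic L e dV hdV dW hdW v u) : ℝ) : ℂ) ^ (2 * s + (n : ℂ)) := by
  rw [siegelCharLoc_apply, siegelDeltaCharacter, chiDet_one_character, Units.val_one, one_mul]

/-! ## §2 The Siegel modulus of the Cartan representatives, read off ★ #27i -/

/-- **THE CARTAN REPRESENTATIVE IS SIEGEL-INTEGRALLY DECOMPOSABLE WITH MODULUS `√‖ϖ‖^m`**: at an inert place, for `t ∈ G_v` with
`t_w = T⁻¹·diag(ϖ^m, ϖ^{−m})·T` in an integral hyperbolic frame, `ι_v(t, 1) = p·k` with `p ∈ P_Δ(L⁺_v)`, `k ∈ K_{H,v}` and `modDelta(ι_v^H p) = √‖ϖ‖_w^m`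
— read off ★ #27i at the trivial character and `s = 1 − n/2` (no matrices). [cite: Li1992, §3 Thm. 3.1] [cite: Liu2011, §2C (2-4) p. 863] -/
theorem exists_decomp_modDelta_cartan_inert (w : UnitaryGroup.PlacesOver L v) (hw : IsCMField.complexConj L • w.1 = w.1)
    {ϖ : w.1.adicCompletion L} (hϖ : Valued.v ϖ = WithZero.exp (-1 : ℤ))
    (hϖσ : galAdicCompletionMap (L := L) (IsCMField.complexConj L) hw ϖ = ϖ)
    (T : GL (Fin 2) (w.1.adicCompletion L)) (hTi : T ∈ glInt 2 (w.1.adicCompletion L))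
    (hTJ : UnitaryGroup.placeForm (Matrix.diagonal dV) w.1 =
      formCongr (galAdicCompletionMap (L := L) (IsCMField.complexConj L) hw) T ((StdForm.antidiagonal 2).over (w.1.adicCompletion L)))
    (m : ℕ) (t : UnitaryGroup.localPi L (IsCMField.complexConj L) 2 (Matrix.diagonal dV) v)
    (ht : Units.val ((t : UnitaryGroup.LocalGLPi L 2 v) w) =
      ((T⁻¹ : GL (Fin 2) (w.1.adicCompletion L)) : Matrix (Fin 2) (Fin 2) (w.1.adicCompletion L)) *
        Matrix.diagonal ![ϖ ^ m, (ϖ ^ m)⁻¹] * (T : Matrix (Fin 2) (Fin 2) (w.1.adicCompletion L))) :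
    ∃ p k : UnitaryGroup.localPi L (IsCMField.complexConj L) (n + n) (hermD L e dV hdV dW hdW) v,
      p ∈ siegelDeltaLoc L e dV hdV dW hdW v ∧
      k ∈ UnitaryGroup.localInt L (IsCMField.complexConj L) (n + n) (hermD L e dV hdV dW hdW) v ∧
      iotaLeftLocPi L e dV hdV dW hdW v t = p * k ∧
      modDelta L e dV hdV dW hdW (locToAdelic L e dV hdV dW hdW v p) = Real.sqrt ‖ϖ‖ ^ m := by
  classical
  have hϖ0 : ϖ ≠ 0 := fun h0 => by rw [h0, map_zero] at hϖ; exact WithZero.exp_ne_zero hϖ.symm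
  have hun : ∀ w' : UnitaryGroup.PlacesOver L v, (1 : HeckeCharacter L).IsUnramifiedAt w'.1 := fun w' => isUnramifiedAt_one L w'.1
  -- ★ #27i at the trivial character and `s := 1 − n/2`: `Λ_{s,v}(ι_v(t,1)) = ‖ϖ‖^m`
  obtain ⟨s, hs1, hs2⟩ : ∃ s : ℂ, s + (n : ℂ) / 2 = 1 ∧ 2 * s + (n : ℂ) = 2 := ⟨1 - (n : ℂ) / 2, by ring, by ring⟩
  have hΛ := lambdaLoc_iotaLeftLocPi_cartan_inert L e dV hdV dW hdW v 1 s hun w hw hϖ hϖσ T hTi hTJ m t ht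
  rw [valueAtUniformizer_one, one_pow, one_mul, hs1, Complex.cpow_one] at hΛ
  -- hence `ι_v(t,1)` is Siegel-integrally decomposable (`Λ` is `0` off `P_Δ·K_H`)
  have hne : LambdaLoc L e dV hdV dW hdW v (1 : HeckeCharacter L) s (iotaLeftLocPi L e dV hdV dW hdW v t) ≠ 0 := by
    rw [hΛ]
    exact Complex.ofReal_ne_zero.2 (pow_pos (norm_pos_iff.2 hϖ0) m).ne'
  have hdec : ∃ pk, IsSiegelIntDecomp L e dV hdV dW hdW v (iotaLeftLocPi L e dV hdV dW hdW v t) pk := by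
    by_contra h
    exact hne (lambdaLoc_eq_zero L e dV hdV dW hdW v 1 s h)
  obtain ⟨⟨p, k⟩, hp, hk, hx⟩ := hdec
  refine ⟨p, k, hp, hk, hx, ?_⟩
  -- and `Λ = siegelCharLoc(p) = modDelta(ι_v^H p)²`
  have h2 : LambdaLoc L e dV hdV dW hdW v (1 : HeckeCharacter L) s (iotaLeftLocPi L e dV hdV dW hdW v t) =
      siegelCharLoc L e dV hdV dW hdW v (1 : HeckeCharacter L) s p := by
    rw [hx]
    exact lambdaLoc_mul_eq L e dV hdV dW hdW v 1 s hun hp hk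
  rw [h2, siegelCharLoc_one_character, hs2, Complex.cpow_two] at hΛ
  have hmd : 0 ≤ modDelta L e dV hdV dW hdW (locToAdelic L e dV hdV dW hdW v p) := (modDelta_pos L e dV hdV dW hdW _).le
  have hsq : modDelta L e dV hdV dW hdW (locToAdelic L e dV hdV dW hdW v p) ^ 2 = ‖ϖ‖ ^ m := by exact_mod_cast hΛ
  -- `√(‖ϖ‖^m) = (√‖ϖ‖)^m` (★ `real_sqrt_pow`, inlined)
  rw [← Real.sqrt_sq hmd, hsq, show ‖ϖ‖ ^ m = (Real.sqrt ‖ϖ‖ ^ m) ^ 2 by rw [← pow_mul, mul_comm, pow_mul, Real.sq_sqrt (norm_nonneg _)],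
    Real.sqrt_sq (pow_nonneg (Real.sqrt_nonneg _) m)]

/-! ## §3 The decay -/

/-- **HEIGHT DECAY ALONG THE INERT CARTAN FAMILY**: `Φ(ι_v^H(ι_v(t m, 1))) ≤ C·(√‖ϖ‖_w)^m` (and `(√‖ϖ‖_w)^m ≤ C·Φ(…)`) for every continuous
height `Φ > 0` of type `(P_Δ, modDelta)` on `H(𝔸)` — §2 + ★ (EV) `exists_twoSided_modDelta_of_localDecomp`.
[cite: Li1992, §3 Thm. 3.1] [cite: GelbartPiatetskishapiroRallis1987, Part A §6] [cite: Liu2011, §2C p. 863] -/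
theorem exists_decay_cartan_inert (w : UnitaryGroup.PlacesOver L v) (hw : IsCMField.complexConj L • w.1 = w.1)
    {ϖ : w.1.adicCompletion L} (hϖ : Valued.v ϖ = WithZero.exp (-1 : ℤ))
    (hϖσ : galAdicCompletionMap (L := L) (IsCMField.complexConj L) hw ϖ = ϖ)
    (T : GL (Fin 2) (w.1.adicCompletion L)) (hTi : T ∈ glInt 2 (w.1.adicCompletion L))
    (hTJ : UnitaryGroup.placeForm (Matrix.diagonal dV) w.1 =
      formCongr (galAdicCompletionMap (L := L) (IsCMField.complexConj L) hw) T ((StdForm.antidiagonal 2).over (w.1.adicCompletion L)))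
    (t : ℕ → UnitaryGroup.localPi L (IsCMField.complexConj L) 2 (Matrix.diagonal dV) v)
    (ht : ∀ m, Units.val ((t m : UnitaryGroup.LocalGLPi L 2 v) w) =
      ((T⁻¹ : GL (Fin 2) (w.1.adicCompletion L)) : Matrix (Fin 2) (Fin 2) (w.1.adicCompletion L)) *
        Matrix.diagonal ![ϖ ^ m, (ϖ ^ m)⁻¹] * (T : Matrix (Fin 2) (Fin 2) (w.1.adicCompletion L)))
    {Φ : HA L e dV hdV dW hdW → ℝ} (hΦc : Continuous Φ) (hΦpos : ∀ x, 0 < Φ x)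
    (hΦ : ∀ p x : HA L e dV hdV dW hdW, IsSiegelDelta L e dV hdV dW hdW p →
      Φ (p * x) = modDelta L e dV hdV dW hdW p * Φ x) :
    ∃ C : ℝ, 0 < C ∧ ∀ m,
      Φ (locToAdelic L e dV hdV dW hdW v (iotaLeftLocPi L e dV hdV dW hdW v (t m))) ≤ C * Real.sqrt ‖ϖ‖ ^ m ∧
        Real.sqrt ‖ϖ‖ ^ m ≤ C * Φ (locToAdelic L e dV hdV dW hdW v (iotaLeftLocPi L e dV hdV dW hdW v (t m))) := by
  obtain ⟨C, hC, hb⟩ := exists_twoSided_modDelta_of_localDecomp L e dV hdV dW hdW v hΦc hΦpos hΦ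
  refine ⟨C, hC, fun m => ?_⟩
  obtain ⟨p, k, hp, hk, hx, hmod⟩ := exists_decomp_modDelta_cartan_inert L e dV hdV dW hdW v w hw hϖ hϖσ T hTi hTJ m (t m) (ht m)
  have hX : locToAdelic L e dV hdV dW hdW v (iotaLeftLocPi L e dV hdV dW hdW v (t m)) =
      locToAdelic L e dV hdV dW hdW v p * locToAdelic L e dV hdV dW hdW v k := by
    rw [hx, map_mul]
  rw [← hmod]
  exact hb _ p k hp hk hX

/-- **THE SAME FOR THE #32d SLICE OF THE `H`-FRAME** (`v ∈ S` inert, frame `ᵗ(c g)(t₀ • H) g = diag dV`, `ιA` pinned): along the transported family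
`m ↦ κ_v⁻¹(t m)` (`κ_v = localCongr g⁻¹ … v : U(H)(L⁺_v) ≃ₜ* U(diag dV)(L⁺_v)`, ★ D5) the slice decays like `(√‖ϖ‖_w)^m` — the `hdec` of ★ (NS-i)
`integrable_placeSlice_of_rankOneDecay` with `r = √‖ϖ‖_w`. [cite: Li1992, §3 Thm. 3.1] [cite: Liu2011, §2C p. 863] [cite: PlatonovRapinchuk1994, §2.3] -/
theorem exists_sliceDecay_cartan_inert (H : Matrix (Fin 2) (Fin 2) L) (t₀ : L) (ht₀ : t₀ ≠ 0) (g : GL (Fin 2) L)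
    (hg : formCongr ((IsCMField.complexConj L : L ≃ₐ[↥(maximalRealSubfield L)] L) : L →+* L) g (t₀ • H) = Matrix.diagonal dV)
    (ιA : (UnitaryGroup.adelicGroupData (Fp L) L (IsCMField.complexConj L) 2 H).Adelic →*
      UnitaryGroup.adelic (Fp L) L (IsCMField.complexConj L) 2 (Matrix.diagonal dV))
    (hιA : ∀ k, ((ιA k : ↥(UnitaryGroup.adelic (Fp L) L (IsCMField.complexConj L) 2 (Matrix.diagonal dV))) :
          GL (Fin 2) (AdeleRing (𝓞 L) L)) =
        (toAdeleGL L g)⁻¹ * UnitaryGroup.adelicVal (Fp L) L (IsCMField.complexConj L) 2 H k * toAdeleGL L g)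
    (S : Finset (HeightOneSpectrum (𝓞 (Fp L)))) [DecidableEq (HeightOneSpectrum (𝓞 (Fp L)))] (vS : S) (hvS : vS.1 = v)
    (w : UnitaryGroup.PlacesOver L v) (hw : IsCMField.complexConj L • w.1 = w.1)
    {ϖ : w.1.adicCompletion L} (hϖ : Valued.v ϖ = WithZero.exp (-1 : ℤ))
    (hϖσ : galAdicCompletionMap (L := L) (IsCMField.complexConj L) hw ϖ = ϖ)
    (T : GL (Fin 2) (w.1.adicCompletion L)) (hTi : T ∈ glInt 2 (w.1.adicCompletion L))
    (hTJ : UnitaryGroup.placeForm (Matrix.diagonal dV) w.1 =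
      formCongr (galAdicCompletionMap (L := L) (IsCMField.complexConj L) hw) T ((StdForm.antidiagonal 2).over (w.1.adicCompletion L)))
    (t : ℕ → UnitaryGroup.localPi L (IsCMField.complexConj L) 2 (Matrix.diagonal dV) v)
    (ht : ∀ m, Units.val ((t m : UnitaryGroup.LocalGLPi L 2 v) w) =
      ((T⁻¹ : GL (Fin 2) (w.1.adicCompletion L)) : Matrix (Fin 2) (Fin 2) (w.1.adicCompletion L)) *
        Matrix.diagonal ![ϖ ^ m, (ϖ ^ m)⁻¹] * (T : Matrix (Fin 2) (Fin 2) (w.1.adicCompletion L)))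
    {Φ : HA L e dV hdV dW hdW → ℝ} (hΦc : Continuous Φ) (hΦpos : ∀ x, 0 < Φ x)
    (hΦ : ∀ p x : HA L e dV hdV dW hdW, IsSiegelDelta L e dV hdV dW hdW p →
      Φ (p * x) = modDelta L e dV hdV dW hdW p * Φ x) :
    ∃ C : ℝ, 0 < C ∧ ∀ m,
      Φ (iotaLeft L e dV hdV dW hdW (ιA (placesEmbed L H S (1, Pi.mulSingle vS
        ((localCongr L (IsCMField.complexConj L) g⁻¹ (inv_ne_zero ht₀) (formCongr_inv_inv_smul L H dV t₀ ht₀ g hg) vS.1).symm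
          (hvS ▸ t m)))))) ≤ C * Real.sqrt ‖ϖ‖ ^ m := by
  subst hvS
  obtain ⟨C, hC, hb⟩ := exists_decay_cartan_inert L e dV hdV dW hdW vS.1 w hw hϖ hϖσ T hTi hTJ t ht hΦc hΦpos hΦ
  refine ⟨C, hC, fun m => ?_⟩
  rw [iotaLeft_iotaA_placesEmbed_mulSingle L e dV hdV dW hdW H t₀ ht₀ g hg ιA hιA S vS, ContinuousMulEquiv.apply_symm_apply]
  exact (hb m).1

end Summit.HodgeConjecture.HodgeConjecture.Cruxes.HLiu418.K2LiuNonsplitCartanDecayInert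

end
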